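import Summits.CriticalPhenomena.CardyFormulaZ2.Theorems.CardyBoundaryCoulombGasHalfPlaneMarkDensityLawSubsequentialLimits
import Summits.CriticalPhenomena.CardyFormulaZ2.Theorems.CardyBoundaryCoulombGasHalfPlaneMarkDensityLawSelfDualityExact
import Literature.Probability.Percolation.Z2HalfPlaneThreeArm

/-!
# `HalfPlaneMarkDensityLaw` (crux stmt-CriticalPhenomena-5661), line `Sketch`, gap closing:
# stub `stub_jointLimit_tendsto_one_of` (G7') — joint subsequential limits tend to `1` as the gap closes

Pure analysis (squeeze).  `P_n(a,b,c,y) = P_{1/2}[[⌊an⌋,⌊bn⌋]×{0} ↔ [⌊cn⌋,⌊yn⌋]×{0} in ℤ×ℕ]` and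
`G a b c y` is, on the chamber `a < b < c < y`, the limit of `P_{θ n}(a,b,c,y)` along a strictly
increasing `θ`; in particular `G a b c y ≤ 1` (`Subseq.jointLimit_mem_Icc`).

Lower bound.  Fix `a < b < y` and put `d := min (b − a) ((y − b)/2) > 0`.  For `b < c < b + η`,
`η := min ((y − b)/2) (d/K)`, we have `c < y`, `K (c − b) < d ≤ b − a` and `d ≤ y − c`, so the
hypothesis (G6) gives `1 − C₁ (2(c−b)/d)^α ≤ P_n(a,b,c,y)` eventually, hence eventually along `θ`
(`StrictMono.tendsto_atTop`), and passing to the limit `1 − C₁ (2(c−b)/d)^α ≤ G a b c y`.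

Squeeze.  The lower envelope `c ↦ 1 − C₁ (2(c−b)/d)^α` is continuous at `b` with value `1`
(`Real.continuousAt_rpow_const`, `Real.zero_rpow`), the upper envelope is the constant `1`, and
`tendsto_of_tendsto_of_tendsto_of_le_of_le'` on `𝓝[>] b` concludes.
-/

noncomputable section

namespace Summit.CriticalPhenomena.CardyFormulaZ2.Cruxes.HalfPlaneMarkDensityLaw.SketchLine

open Literature.Probability.Percolation Literature.Probability.LatticeModels
open Literature.Probability.Percolation.Z2HalfPlane (leg Far faceBox oneArm)
open MeasureTheory Filter Set SimpleGraph
open scoped Topology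
open Summit.CriticalPhenomena.CardyFormulaZ2.Theorems.HalfPlaneMarkDensityLaw.Negative

namespace GapClose

/-- The lower envelope `c ↦ 1 − C₁ (2(c−b)/d)^α` tends to `1` as `c → b` when `α > 0`. [folklore] -/
lemma tendsto_one_sub_const_mul_rpow {C₁ α d b : ℝ} (hα : 0 < α) :
    Tendsto (fun c : ℝ ↦ 1 - C₁ * (2 * (c - b) / d) ^ α) (𝓝 b) (𝓝 1) := by
  have hc : ContinuousAt (fun c : ℝ ↦ 1 - C₁ * (2 * (c - b) / d) ^ α) b := by
    refine ContinuousAt.sub continuousAt_const (ContinuousAt.mul continuousAt_const ?_)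
    exact (Real.continuousAt_rpow_const _ α (Or.inr hα.le)).comp (by fun_prop)
  have h0 : 1 - C₁ * (2 * (b - b) / d) ^ α = 1 := by
    simp [Real.zero_rpow hα.ne']
  have := hc.tendsto
  rw [h0] at this
  exact this

/-- STUB G7' (glue): G6 gives G7 (squeeze between `1 − C₁(2(c−b)/d)^α` and `1`): **every joint
subsequential limit tends to `1` as the gap closes.** [folklore] -/
theorem stub_jointLimit_tendsto_one_of :
    (∃ C₁ α K : ℝ, 0 < C₁ ∧ 0 < α ∧ 0 < K ∧ ∀ (a b c y d : ℝ), a < b → b < c → c < y → K * (c - b) < d → d ≤ b - a → d ≤ y - c → ∀ᶠ n : ℕ in atTop, 1 - C₁ * (2 * (c - b) / d) ^ α ≤ μ.real (openCrossing halfPlane (arcA a b n) (rowIcc ⌊c * n⌋ ⌊y * n⌋))) →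
    ∀ {θ : ℕ → ℕ} {G : ℝ → ℝ → ℝ → ℝ → ℝ}, (∀ a b c y : ℝ, a < b → b < c → c < y → Tendsto (fun n ↦ μ.real (openCrossing halfPlane (arcA a b (θ n)) (rowIcc ⌊c * (θ n : ℕ)⌋ ⌊y * (θ n : ℕ)⌋))) atTop (𝓝 (G a b c y))) → StrictMono θ → ∀ {a b y : ℝ}, a < b → b < y → Tendsto (fun c ↦ G a b c y) (𝓝[>] b) (𝓝 1) := by
  rintro ⟨C₁, α, K, _hC₁, hα, hK, hev⟩ θ G hG hθ a b y hab hby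
  -- the scale `d` and the window `η`
  obtain ⟨d, hd0, hda, hdy⟩ : ∃ d : ℝ, 0 < d ∧ d ≤ b - a ∧ d ≤ (y - b) / 2 :=
    ⟨min (b - a) ((y - b) / 2), lt_min (by linarith) (by linarith), min_le_left _ _, min_le_right _ _⟩
  obtain ⟨η, hη0, hη1, hη2⟩ : ∃ η : ℝ, 0 < η ∧ η ≤ (y - b) / 2 ∧ η ≤ d / K :=
    ⟨min ((y - b) / 2) (d / K), lt_min (by linarith) (div_pos hd0 hK), min_le_left _ _,
      min_le_right _ _⟩
  -- lower bound on the window `b < c < b + η`, passing (G6) to the limit along `θ`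
  have hlow : ∀ c : ℝ, b < c → c < b + η → 1 - C₁ * (2 * (c - b) / d) ^ α ≤ G a b c y := by
    intro c hbc hcη
    have hcy : c < y := by linarith
    have hKc : K * (c - b) < d := (lt_div_iff₀' hK).1 (by linarith)
    have hdc : d ≤ y - c := by linarith
    exact ge_of_tendsto (hG a b c y hab hbc hcy)
      (hθ.tendsto_atTop.eventually (hev a b c y d hab hbc hcy hKc hda hdc))
  -- squeeze between the lower envelope and the constant `1`
  refine tendsto_of_tendsto_of_tendsto_of_le_of_le'
    ((tendsto_one_sub_const_mul_rpow (C₁ := C₁) (d := d) (b := b) hα).mono_left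
      nhdsWithin_le_nhds) tendsto_const_nhds ?_ ?_
  · filter_upwards [Ioo_mem_nhdsGT (show b < b + η by linarith)] with c hc
    exact hlow c hc.1 hc.2
  · filter_upwards [Ioo_mem_nhdsGT hby] with c hc
    exact (Subseq.jointLimit_mem_Icc hG hab hc.1 hc.2).2

end GapClose

end Summit.CriticalPhenomena.CardyFormulaZ2.Cruxes.HalfPlaneMarkDensityLaw.SketchLine

end
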